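import Mathlib
import Summits.MatrixMultiplication.MatrixMultiplication.Theorems.LieRankDesigns.Negative.Basics
import Summits.MatrixMultiplication.MatrixMultiplication.Theorems.LevelGradedCohnUmansLieRankDesignsStubLevelFixedVector
import Summits.MatrixMultiplication.MatrixMultiplication.Theorems.LevelGradedCohnUmansLieRankDesignsStubParabolicFacts
import Summits.MatrixMultiplication.MatrixMultiplication.Theorems.LevelGradedCohnUmansLieRankDesignsStubOrbitSpanBound
import Summits.MatrixMultiplication.MatrixMultiplication.Theorems.LevelGradedCohnUmansLieRankDesignsStubRegularCount
import Summits.MatrixMultiplication.MatrixMultiplication.Theorems.LevelGradedCohnUmansLieRankDesignsStubCentralDegreeBound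
import Summits.MatrixMultiplication.MatrixMultiplication.Theorems.LevelGradedCohnUmansLieRankDesignsStubBudgetGlue
import Summits.MatrixMultiplication.MatrixMultiplication.Theorems.LevelGradedCohnUmansLieRankDesignsStubSharpLevelDegree
import HarnessLib.Audit

/-!
# Line `Sketch` — crux `LevelGradedCohnUmans.LieRankDesigns` (stmt-MatrixMultiplication-7614)

LEAD SKELETON v6 (lead seat prover-line-stmt-MatrixMultiplication-7614-c4-0, 2026-08-16T18:30Z; PICKED.md) = v5
(c2/c3, sha 48d0e0d1) unchanged in its Lean content: the landed stubs A–F and I are IMPORTED, the transfers are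
landed (`Theorems/LevelGradedCohnUmansLieRankDesignsUniversality.lean` p116933, `…ExactLevelSet.lean` p116876), and
the only `sorry`s left are the nested design stubs G ⊂ G'' ⊂ G' and the named Literature fact H.  Built from the
two cards of ideator 3 (`Cruxes/LieRankDesigns/Ideas/siegel-triangle-elliptic-twist.md`, `…/frame-duality-level-pinning.md`).
Lead c4 drives G'' through (i) the level-`k` FREE-FRAME CRITERION (generalising c3's `stub_rankSepOfPrivateTokens`,
p117553, from `k = 1` to every level: one `m×k` frame per target whose based quadruple products are injective at the
target ⇒ `RankSep k`; group form: the punctured based triple product misses a conjugate of the frame stabiliser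
`H_k`), (ii) the exact finite-window census of the cells `(m,k,p)`, `m ≤ 6`, and (iii) the level-one token barrier
(see `Lines/Sketch.md`, PICKED.md).

CRUX (by name): `Summit.MatrixMultiplication.MatrixMultiplication.Theses.LevelGradedCohnUmans.LieRankDesigns` —
`∀ ε > 0 ∃ p prime, m, k, X Y Z ⊆ GL_m(𝔽_p)`, rank-`≤ k`-separated (`RankSep`), with
`budget p m k (2+ε) = Σ_{χ ∈ Irr(GL_m(𝔽_p)) ∩ F_k} χ(1)^{2+ε} < (|X||Y||Z|)^{(2+ε)/3}` (vocabulary of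
`Theorems/LieRankDesigns/Negative/Basics.lean`, `lieRankDesigns_iff` is `Iff.rfl`).

THE LINE. Frame duality / level pinning (card `frame-duality-level-pinning`): `F_k` is the coefficient space of the
permutation module on `k`-frames, so `Irr ∩ F_k ⊆ {ρ : ρ^{H_k} ≠ 0}` with `H_k` the pointwise stabiliser of
`e_1, …, e_k`, and every such `ρ` is reached from the maximal parabolic `P_k = Stab⟨e_1,…,e_k⟩ ⊵ H_k`,
`P_k / H_k ≅ GL_k(𝔽_p)`.  This gives an ELEMENTARY graded budget for every fixed cell `(m, k)` (stubs A–F):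
`budget_s ≤ 2^{m(s-1)} p^{(mk - k²/2)s} (p-1)^{-(s-2)/2}` — level pinning with the `p^{ε/2}` of slack that the centre
of the Levi factor `GL_k` supplies (`dim θ² ≤ [P_k : Z_k]` for `H_k`-trivial `P_k`-irreducibles `θ`).  The TRANSFER
(proved below, `LieRankDesigns_of`): constant-factor wall saturation `|X||Y||Z| ≥ c₀ p^{3mk - 3k²/2}` at ONE cell
`(m, k)` along unboundedly many primes gives the crux for EVERY `ε` (the universality lever, triage-passed; at
`(2,1)` it is `LevelOneLink`'s shape, at the siegel-triangle arena `m = 2k` it is the card's `C⁺(2k,k)` with `o(k)`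
replaced by `O(1)`).  Stub G `FixedCellSaturation` is that open packing statement (held by the lead); the
siegel-triangle pieces (radical inflation of a matrix-USP in `GL_k`, elliptic twist; matching identities
`triangle_matching_levi_descent`) are its intended witnesses and ride as helper lemmas of G.

PUBLICATION NOTE (v5, 2026-08-16T13:50Z): stubs A–F, I, K, L are LANDED in `Theorems/` (p87876, p89272, p89717,
p90134, p90736, p91913; I p93375, K p93384, L p93570 — all ACCEPTED) and A–F, I are imported here (one-line `exact`s of
`Theorems.LieRankDesigns.stub_*`).  Also landed: siegel-triangle matching identities (p92653), named fact
`GreenGLnDegreeBound` (p92471).  OPEN: ONLY the design stubs G (fixed cell) ⇒ G'' (near wall, loss p^δ) ⇒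
G' (family, loss p^{δk}); crux ⇐ G'' unconditionally, crux ⇐ G' modulo Green (H).

Stubs (registered; A–F, I, K, L landed; H named fact; G/G''/G' open):
* A `stub_levelFixedVector` (M): `χ ∈ Irr ∩ F_k ⇒ Σ_{h ∈ H_k} χ(h) ≠ 0` (a rank-`≤ k` Fourier mode
  `g ↦ ψ(tr(M g))` is right-invariant under the pointwise stabiliser of `col M ⊆` a `k`-space, a conjugate of `H_k`;
  a character without `H_k`-fixed vectors is orthogonal to all of them, hence to itself).
* B `stub_parabolicFacts` (M/L): the subgroups `H_k ≤ Z_k ≤ P_k` of `GL_m(𝔽_p)` with `H_k ⊴ P_k`,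
  `[P_k, Z_k] ⊆ H_k`, `[G:P_k] ≤ 2^m p^{k(m-k)}`, `[G:H_k] ≤ p^{mk}`, `[P_k:Z_k](p-1) ≤ p^{k²}`.
* C `stub_orbitSpanBound` (M): `ρ` irreducible, `W ≠ 0` `P`-stable ⇒ `dim ρ ≤ [G:P]·dim W` (sum of translates).
* D `stub_regularCount` (S/M): `Σ_{χ ∈ Irr G} χ(1) Σ_{h ∈ H} χ(h) = |G|` (regular character).
* E `stub_centralDegreeBound` (M): `θ` irreducible `P`-rep trivial on `H`, `[P, Z] ⊆ H` ⇒ `dim θ² |Z| ≤ |P|` (Schur).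
* F `stub_budgetGlue` (L): A → B → C → D → E → `CellBudget` (averaging projection `dim ρ^H = |H|⁻¹Σ_H χ`,
  `d ≤ [G:P]√[P:Z]`, `Σ d² ≤ [G:P][G:H]`, `Σ d^s ≤ d_max^{s-2} Σ d²`).
* G `stub_fixedCellSaturation` (XL, OPEN — the crux's construction problem in wall form, strongest form).
* G'' `stub_nearWallDesigns` (XL, OPEN; lead reshape v4 — loss `p^δ`, every `δ`, some cell: the WEAKEST design
  hypothesis with an unconditional transfer; `G ⇒ G'' ⇒ G'`): THE hypothesis of `LieRankDesigns_of`.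
`LieRankDesigns_of : G'' → LieRankDesigns` (with A–F landed) is PROVED below (pure `rpow` bookkeeping); so are
`LieRankDesigns_of_fixedCell : G → …` and the family branch `LieRankDesigns_of_family : H → I → G' → …`.

DISPROOF USED (`Cruxes/LieRankDesigns/Disproof.lean`, cdisprove v1, verdict NO KILL; landed `Negative/Basics.lean`):
the line concludes `RankSep` VERBATIM and keeps the strict `<`, so the load-bearing clauses (`one_le_budget`,
`two_le_volume`, `lieRankDesigns_le_variant`) are honoured; dead slices `k = 0` (`not_lieRankDesigns_levelZero`),
`m = 0`, `m = 1` are never instantiated (G asks `1 ≤ k ≤ m`; at `m = 1` the bound of `CellBudget` is vacuous-true and G is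
false there by `not_design_matOne`, consistently); walls / graded Neumann / pigeonhole / isotropy are consequences of
`RankSep` and constrain only G's witnesses (recorded in G's docstring).  Negatives index: unrelated (abelian STPP frames).
-/

set_option linter.dupNamespace false

noncomputable section

namespace Summit.MatrixMultiplication.MatrixMultiplication.Cruxes.LieRankDesigns.Sketch

open scoped BigOperators
open Literature.RepresentationTheory.FiniteGroups
open Summit.MatrixMultiplication.MatrixMultiplication.Theorems.LieRankDesigns.Negative
  (GLm Mat fourierFn RankSupp RankSep levelSet budget volume lieRankDesigns_iff)

/-! ## Vocabulary -/

/-- `h` fixes the first `k` standard basis vectors (`h e_i = e_i`, `i < k`): the first `k` columns of `h` are those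
of the identity.  The set of such `h` is the frame stabiliser `H_k = {[[1, *], [0, *]]}`. -/
def IsFrameFix (p m k : ℕ) (h : GLm p m) : Prop :=
  ∀ i j : Fin m, (i : ℕ) < k → (h : Mat p m) j i = (1 : Mat p m) j i

/-! ## A — level functions see the frame stabiliser (size M) -/

/-- **A `LevelFixedVector`.** For `1 ≤ k ≤ m` and an irreducible character `χ` of `GL_m(𝔽_p)` lying in the level
`F_k`, `Σ_{h ∈ H_k} χ(h) ≠ 0` (equivalently `ρ_χ` has a non-zero `H_k`-fixed vector).  Proof: a mode
`g ↦ ψ(tr(M g))` with `rk M ≤ k` satisfies `ψ(tr(M g h)) = ψ(tr(h M g))`, so it is right-invariant under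
`{h : h M = M} ⊇ Stab_pw(W)` for any `k`-space `W ⊇ col M`, and `Stab_pw(W) = a H_k a⁻¹`; if `Σ_{H_k} χ = 0` then
`Σ_{h ∈ H_k} ρ(h) = 0`, so `Σ_h χ(x h) = 0` for all `x`, so `⟨χ, f⟩ = 0` for every `f ∈ F_k` — including `f = χ`,
absurd.  Why it might fail: it does not (it is the containment `Irr ∩ F_k ⊆ {ρ : ρ^{H_k} ≠ 0}` of the
frame-duality card, Disproof.lean "Not yet formalised"). -/
def LevelFixedVector : Prop :=
  ∀ (p m k : ℕ) [Fact p.Prime], 1 ≤ k → k ≤ m →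
    ∀ χ ∈ irrChars (GLm p m) ∩ levelSet p m k,
      (∑ᶠ h ∈ {h : GLm p m | IsFrameFix p m k h}, χ h) ≠ 0

/-- Registered stub A (statement = `LevelFixedVector`, `IsFrameFix` inlined). -/
theorem stub_levelFixedVector :
    ∀ (p m k : ℕ) [Fact p.Prime], 1 ≤ k → k ≤ m →
      ∀ χ ∈ irrChars (GLm p m) ∩ levelSet p m k,
        (∑ᶠ h ∈ {h : GLm p m | ∀ i j : Fin m, (i : ℕ) < k → (h : Mat p m) j i = (1 : Mat p m) j i}, χ h) ≠ 0 := by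
  exact fun p m k _ hk hkm χ hχ => Summit.MatrixMultiplication.MatrixMultiplication.Theorems.LieRankDesigns.stub_levelFixedVector p m k hk hkm χ hχ

/-! ## B — the parabolic bookkeeping (size M/L) -/

/-- **B `ParabolicFacts`.** In `G = GL_m(𝔽_p)`, `1 ≤ k ≤ m`: `H = H_k` (frame stabiliser `[[1,*],[0,*]]`),
`Z = Z_k = [[λ·1,*],[0,*]]`, `P = P_k = [[*,*],[0,*]]` (block sizes `k`, `m-k`) are subgroups with `H ≤ Z ≤ P`,
`H ⊴ P` (kernel of `P → GL_k`), `[P, Z] ⊆ H` (`Z/H` = centre of `P/H ≅ GL_k`), and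
`[G:P] = [m choose k]_p ≤ 2^m p^{k(m-k)}`, `[G:H] = #(injective k-frames) ≤ p^{mk}`,
`[P:Z]·(p-1) = |GL_k(𝔽_p)| ≤ p^{k²}`.  Why it might fail: it does not (counting); cost = block matrices over
`Fin m` with `k ≤ m` (`Matrix.card_GL_field`, the hom `P → GL_k`, or crude bounds `|GL_k| ≥ p^{k²}/2^k`). -/
def ParabolicFacts : Prop :=
  ∀ (p m k : ℕ) [Fact p.Prime], 1 ≤ k → k ≤ m →
    ∃ H Z P : Subgroup (GLm p m),
      (∀ h : GLm p m, h ∈ H ↔ IsFrameFix p m k h) ∧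
      H ≤ Z ∧ Z ≤ P ∧
      (∀ g ∈ P, ∀ h ∈ H, g * h * g⁻¹ ∈ H) ∧
      (∀ g ∈ P, ∀ z ∈ Z, g * z * g⁻¹ * z⁻¹ ∈ H) ∧
      (P.index : ℝ) ≤ 2 ^ m * (p : ℝ) ^ (k * (m - k)) ∧
      (H.index : ℝ) ≤ (p : ℝ) ^ (m * k) ∧
      (Z.relIndex P : ℝ) * ((p : ℝ) - 1) ≤ (p : ℝ) ^ (k ^ 2)

/-- Registered stub B (statement = `ParabolicFacts`, `IsFrameFix` inlined). -/
theorem stub_parabolicFacts :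
    ∀ (p m k : ℕ) [Fact p.Prime], 1 ≤ k → k ≤ m →
      ∃ H Z P : Subgroup (GLm p m),
        (∀ h : GLm p m, h ∈ H ↔ ∀ i j : Fin m, (i : ℕ) < k → (h : Mat p m) j i = (1 : Mat p m) j i) ∧
        H ≤ Z ∧ Z ≤ P ∧
        (∀ g ∈ P, ∀ h ∈ H, g * h * g⁻¹ ∈ H) ∧
        (∀ g ∈ P, ∀ z ∈ Z, g * z * g⁻¹ * z⁻¹ ∈ H) ∧
        (P.index : ℝ) ≤ 2 ^ m * (p : ℝ) ^ (k * (m - k)) ∧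
        (H.index : ℝ) ≤ (p : ℝ) ^ (m * k) ∧
        (Z.relIndex P : ℝ) * ((p : ℝ) - 1) ≤ (p : ℝ) ^ (k ^ 2) := by
  exact fun p m k _ hk hkm => Summit.MatrixMultiplication.MatrixMultiplication.Theorems.LieRankDesigns.stub_parabolicFacts p m k hk hkm

/-! ## C — orbit-span degree bound (size M) -/

/-- **C `OrbitSpanBound`.** For an irreducible complex representation `ρ` of a finite group `G` and a non-zero
subspace `W` stable under a subgroup `P`, `dim ρ ≤ [G:P]·dim W`: the sum of the translates `ρ(g)W` over coset
representatives of `G/P` is `G`-stable and non-zero, hence everything.  (Frobenius reciprocity without induction.)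
Why it might fail: it does not. [folklore; Serre, Linear Representations §3.3] -/
def OrbitSpanBound : Prop :=
  ∀ (G : Type) [Group G] [Fintype G] (V : Type) [AddCommGroup V] [Module ℂ V] [FiniteDimensional ℂ V]
    (ρ : Representation ℂ G V), ρ.IsIrreducible →
    ∀ (P : Subgroup G) (W : Submodule ℂ V), W ≠ ⊥ → (∀ g ∈ P, W.map (ρ g) ≤ W) →
      Module.finrank ℂ V ≤ P.index * Module.finrank ℂ W

/-- Registered stub C (statement = `OrbitSpanBound`). -/
theorem stub_orbitSpanBound :
    ∀ (G : Type) [Group G] [Fintype G] (V : Type) [AddCommGroup V] [Module ℂ V] [FiniteDimensional ℂ V]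
      (ρ : Representation ℂ G V), ρ.IsIrreducible →
      ∀ (P : Subgroup G) (W : Submodule ℂ V), W ≠ ⊥ → (∀ g ∈ P, W.map (ρ g) ≤ W) →
        Module.finrank ℂ V ≤ P.index * Module.finrank ℂ W := by
  exact Summit.MatrixMultiplication.MatrixMultiplication.Theorems.LieRankDesigns.stub_orbitSpanBound

/-! ## D — the regular-character count (size S/M) -/

/-- **D `RegularCount`.** For a finite group `G` and a subgroup `H`, `Σ_{χ ∈ Irr G} χ(1)·Σ_{h ∈ H} χ(h) = |G|`:
`Σ_χ χ(1) χ = reg` (`classInner_leftRegular` + `IsClassFun.eq_sum_classInner_smul`) and `reg(h) = |G|[h = 1]`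
(`character_leftRegular`).  Equivalently `Σ_χ d_χ · dim ρ_χ^H = [G:H]` (the permutation character of `G/H`).
Why it might fail: it does not. [folklore; Serre §2.4 Cor. 1] -/
def RegularCount : Prop :=
  ∀ (G : Type) [Group G] [Fintype G] (H : Subgroup G),
    ∑ᶠ χ ∈ irrChars G, χ 1 * ∑ᶠ h ∈ (H : Set G), χ h = (Fintype.card G : ℂ)

/-- Registered stub D (statement = `RegularCount`). -/
theorem stub_regularCount :
    ∀ (G : Type) [Group G] [Fintype G] (H : Subgroup G),
      ∑ᶠ χ ∈ irrChars G, χ 1 * ∑ᶠ h ∈ (H : Set G), χ h = (Fintype.card G : ℂ) := by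
  exact Summit.MatrixMultiplication.MatrixMultiplication.Theorems.LieRankDesigns.stub_regularCount

/-! ## E — the central degree bound (size M) -/

/-- **E `CentralDegreeBound`.** `P` finite, `H, Z ≤ P` with `[P, Z] ⊆ H`, `θ` an irreducible complex
representation of `P` trivial on `H`: then `θ(z)` commutes with `θ(P)` for `z ∈ Z`, so it is a scalar (Schur,
`algebraMap_intertwiningMap_bijective_of_isAlgClosed`), `|χ_θ(z)| = dim θ` on `Z`, and
`|Z|·dim θ² ≤ Σ_P |χ_θ|² = |P|` (`char_orthonormal`).  Why it might fail: it does not. [folklore; Isaacs (2.27)/(3.12) style] -/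
def CentralDegreeBound : Prop :=
  ∀ (P : Type) [Group P] [Fintype P] (H Z : Subgroup P),
    (∀ g : P, ∀ z ∈ Z, g * z * g⁻¹ * z⁻¹ ∈ H) →
    ∀ (W : Type) [AddCommGroup W] [Module ℂ W] [FiniteDimensional ℂ W] (θ : Representation ℂ P W),
      θ.IsIrreducible → (∀ h ∈ H, θ h = LinearMap.id) →
        Module.finrank ℂ W ^ 2 * Nat.card Z ≤ Nat.card P

/-- Registered stub E (statement = `CentralDegreeBound`). -/
theorem stub_centralDegreeBound :
    ∀ (P : Type) [Group P] [Fintype P] (H Z : Subgroup P),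
      (∀ g : P, ∀ z ∈ Z, g * z * g⁻¹ * z⁻¹ ∈ H) →
      ∀ (W : Type) [AddCommGroup W] [Module ℂ W] [FiniteDimensional ℂ W] (θ : Representation ℂ P W),
        θ.IsIrreducible → (∀ h ∈ H, θ h = LinearMap.id) →
          Module.finrank ℂ W ^ 2 * Nat.card Z ≤ Nat.card P := by
  exact Summit.MatrixMultiplication.MatrixMultiplication.Theorems.LieRankDesigns.stub_centralDegreeBound

/-! ## F — the budget glue: level pinning with the centre's slack (size L) -/

/-- **`CellBudget`** — the elementary graded budget of the cell `(m, k)`: for `p` prime, `1 ≤ k ≤ m`, `s ≥ 2`,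
`budget p m k s · (p-1)^{(s-2)/2} ≤ 2^{m(s-1)} · p^{(mk - k²/2)·s}`.
(True shape: `budget_s ≍ p^{(2mk-k²) + (s-2)(mk-k²/2-k/2)}`; the Harish-Chandra saving `p^{-(s-2)k/2}` is replaced
by the centre's `(p-1)^{-(s-2)/2}`, which is all the fixed-cell transfer needs.) -/
def CellBudget : Prop :=
  ∀ (p m k : ℕ) [Fact p.Prime], 1 ≤ k → k ≤ m → ∀ s : ℝ, 2 ≤ s →
    budget p m k s * ((p : ℝ) - 1) ^ ((s - 2) / 2) ≤
      2 ^ ((m : ℝ) * (s - 1)) * (p : ℝ) ^ (((m : ℝ) * k - (k : ℝ) ^ 2 / 2) * s)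

/-- **F `BudgetGlue`**: `A → B → C → D → E → CellBudget`.  For `χ ∈ Irr ∩ F_k` with realisation `ρ` on `V`
(`IsIrrChar`), `d = χ(1)`: `dim V^{H} = |H|⁻¹ Σ_H χ ≠ 0` (A, B's description of `H`,
`Representation.isProj_averageMap` / `LinearMap.IsProj.trace`); `V^H` is `P`-stable (`H ⊴ P`), so C gives
`d ≤ [G:P]·dim V^H`; an irreducible `P`-subrepresentation `W' ≤ V^H` (exists, `IsSimpleOrder`/finite dimension) is
`H`-trivial, so E (with `Z.subgroupOf P`, `[P,Z] ⊆ H`) gives `dim W'² ≤ [P:Z]` and C gives `d ≤ [G:P]·dim W'`;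
hence `d ≤ [G:P]√[P:Z]` and `Σ_{Irr ∩ F_k} d² ≤ [G:P] Σ_χ d·dim V_χ^H ≤ [G:P][G:H]` (D, all terms `≥ 0`);
finally `Σ d^s ≤ (max d)^{s-2} Σ d²` and B's three index bounds.  Why it might fail: it does not; cost L
(character ↔ representation bridges, `finsum` bookkeeping). -/
def BudgetGlue : Prop :=
  LevelFixedVector → ParabolicFacts → OrbitSpanBound → RegularCount → CentralDegreeBound → CellBudget

/-- Registered stub F (statement = `BudgetGlue`, every hypothesis A–E and `CellBudget` spelled out in tree-only
vocabulary, so that the landed helper can carry the identical signature without importing this file). -/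
theorem stub_budgetGlue :
    (∀ (p m k : ℕ) [Fact p.Prime], 1 ≤ k → k ≤ m →
      ∀ χ ∈ irrChars (GLm p m) ∩ levelSet p m k,
        (∑ᶠ h ∈ {h : GLm p m | ∀ i j : Fin m, (i : ℕ) < k → (h : Mat p m) j i = (1 : Mat p m) j i}, χ h) ≠ 0) →
    (∀ (p m k : ℕ) [Fact p.Prime], 1 ≤ k → k ≤ m →
      ∃ H Z P : Subgroup (GLm p m),
        (∀ h : GLm p m, h ∈ H ↔ ∀ i j : Fin m, (i : ℕ) < k → (h : Mat p m) j i = (1 : Mat p m) j i) ∧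
        H ≤ Z ∧ Z ≤ P ∧
        (∀ g ∈ P, ∀ h ∈ H, g * h * g⁻¹ ∈ H) ∧
        (∀ g ∈ P, ∀ z ∈ Z, g * z * g⁻¹ * z⁻¹ ∈ H) ∧
        (P.index : ℝ) ≤ 2 ^ m * (p : ℝ) ^ (k * (m - k)) ∧
        (H.index : ℝ) ≤ (p : ℝ) ^ (m * k) ∧
        (Z.relIndex P : ℝ) * ((p : ℝ) - 1) ≤ (p : ℝ) ^ (k ^ 2)) →
    (∀ (G : Type) [Group G] [Fintype G] (V : Type) [AddCommGroup V] [Module ℂ V] [FiniteDimensional ℂ V]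
      (ρ : Representation ℂ G V), ρ.IsIrreducible →
      ∀ (P : Subgroup G) (W : Submodule ℂ V), W ≠ ⊥ → (∀ g ∈ P, W.map (ρ g) ≤ W) →
        Module.finrank ℂ V ≤ P.index * Module.finrank ℂ W) →
    (∀ (G : Type) [Group G] [Fintype G] (H : Subgroup G),
      ∑ᶠ χ ∈ irrChars G, χ 1 * ∑ᶠ h ∈ (H : Set G), χ h = (Fintype.card G : ℂ)) →
    (∀ (P : Type) [Group P] [Fintype P] (H Z : Subgroup P),
      (∀ g : P, ∀ z ∈ Z, g * z * g⁻¹ * z⁻¹ ∈ H) →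
      ∀ (W : Type) [AddCommGroup W] [Module ℂ W] [FiniteDimensional ℂ W] (θ : Representation ℂ P W),
        θ.IsIrreducible → (∀ h ∈ H, θ h = LinearMap.id) →
          Module.finrank ℂ W ^ 2 * Nat.card Z ≤ Nat.card P) →
    ∀ (p m k : ℕ) [Fact p.Prime], 1 ≤ k → k ≤ m → ∀ s : ℝ, 2 ≤ s →
      budget p m k s * ((p : ℝ) - 1) ^ ((s - 2) / 2) ≤
        2 ^ ((m : ℝ) * (s - 1)) * (p : ℝ) ^ (((m : ℝ) * k - (k : ℝ) ^ 2 / 2) * s) := by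
  exact Summit.MatrixMultiplication.MatrixMultiplication.Theorems.LieRankDesigns.stub_budgetGlue

/-! ## G — fixed-cell wall saturation (the closer; size XL, OPEN) -/

/-- **G `FixedCellSaturation`** (the line's Transfer `C⁺`; hardest stub — the crux's construction problem in wall
form, held by the lead).  There are a cell `(m, k)`, `1 ≤ k ≤ m`, and `c₀ > 0` such that for unboundedly many
primes `p` some rank-`≤ k`-separated triple `X, Y, Z ⊆ GL_m(𝔽_p)` has `|X||Y||Z| ≥ c₀ · p^{3mk - 3k²/2}`
(`= c₀'·D_k^{3/2}`, the graded wall up to a constant).  Intended witnesses (card siegel-triangle-elliptic-twist,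
`m = 2k`): `X = U(E₂)·𝒜`, `Y = U(E₃)^φ·ℬ`, `Z = U(E₁)·𝒟` — radical inflation of a MATRIX-USP `(𝒜, ℬ, 𝒟)` in
`GL_k × M_k` by the unipotent radicals of the three parabolics of a Siegel triangle `E₁ ⊕ E₂ = 𝔽_p^{2k} ⊃ E₃ =
graph φ`, `φ` regular elliptic (TPP-exact by the matching identities; budget-neutral).  NECESSARY filters every
witness meets (Disproof.lean): three walls `|X||Y|, |X||Z|, |Y||Z| ≤ N_k`, graded Neumann `V ≤ 0.385 N_k^{3/2}`,
pigeonhole `|X||Y| + |Y||Z| ≤ |G|` and isotropy `|X||Z| + |X⁻¹YY⁻¹Z| ≤ |G|` (`p` odd, `2k < m`), BALANCE (no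
design set is a union of cosets of a `k`-frame-transitive subgroup).  Why it might fail: at `(2,1)` every search
plateaus at `V ≈ p³ = Θ(D)` against the needed `p^{4.5}` (triage r1-2 conjectures a level-one barrier); no cell is
known to saturate; a fixed-cell barrier `V = o(D_k^{3/2})` kills THIS stub (then the `k → ∞` form with `p^{-o(k)}`
loss and the sharp Harish-Chandra budget is the reshape).  [cite: CohnUmans2003 Prop 10–11;
BlasiakCohnGrochowPrattUmans2024 Thm 3.3; BlasiakCohnGrochowPrattUmans2023 Thm 3.2] -/
def FixedCellSaturation : Prop :=
  ∃ m k : ℕ, 1 ≤ k ∧ k ≤ m ∧ ∃ c₀ : ℝ, 0 < c₀ ∧ ∀ p₀ : ℕ, ∃ (p : ℕ) (_ : Fact p.Prime), p₀ ≤ p ∧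
    ∃ X Y Z : Finset (GLm p m), RankSep k X Y Z ∧
      c₀ * (p : ℝ) ^ (3 * (m : ℝ) * k - 3 / 2 * (k : ℝ) ^ 2) ≤ volume X Y Z

/-- Registered stub G (statement = `FixedCellSaturation`, unfolded one level). -/
theorem stub_fixedCellSaturation :
    ∃ m k : ℕ, 1 ≤ k ∧ k ≤ m ∧ ∃ c₀ : ℝ, 0 < c₀ ∧ ∀ p₀ : ℕ, ∃ (p : ℕ) (_ : Fact p.Prime), p₀ ≤ p ∧
      ∃ X Y Z : Finset (GLm p m), RankSep k X Y Z ∧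
        c₀ * (p : ℝ) ^ (3 * (m : ℝ) * k - 3 / 2 * (k : ℝ) ^ 2) ≤ volume X Y Z := by
  sorry

/-! ## G'' — near-wall designs: the weakest design hypothesis with an UNCONDITIONAL transfer (lead reshape v4) -/

/-- **G'' `NearWallDesigns`** (OPEN, held by the lead; the hypothesis of the unconditional skeleton theorem
`LieRankDesigns_of`): for every loss `δ > 0` some cell `(m, k)`, `1 ≤ k ≤ m`, carries, along unboundedly many primes
`p`, rank-`≤ k`-separated triples with `|X||Y||Z| ≥ p^{3mk - 3k²/2 - δ}` (the wall up to `p^{δ}`; the cell may depend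
on `δ`).  `G ⇒ G'' ⇒ G'` (`nearWallDesigns_of_fixedCell`, `familySaturation_of_nearWall`); the transfer from G'' needs
only the centre's slack `(p-1)^{ε/2}` of `CellBudget`, hence is unconditional, while G' (loss `p^{δk}`) needs Green's
degree bound.  Refuting G'' = a fixed-cell barrier `V ≤ C p^{3mk-3k²/2-η(m,k)}` with `inf_{cells} η > 0`. -/
def NearWallDesigns : Prop :=
  ∀ δ : ℝ, 0 < δ → ∃ m k : ℕ, 1 ≤ k ∧ k ≤ m ∧ ∀ p₀ : ℕ, ∃ (p : ℕ) (_ : Fact p.Prime), p₀ ≤ p ∧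
    ∃ X Y Z : Finset (GLm p m), RankSep k X Y Z ∧
      (p : ℝ) ^ (3 * (m : ℝ) * k - 3 / 2 * (k : ℝ) ^ 2 - δ) ≤ volume X Y Z

/-- Registered stub G'' (statement = `NearWallDesigns`, unfolded one level). -/
theorem stub_nearWallDesigns :
    ∀ δ : ℝ, 0 < δ → ∃ m k : ℕ, 1 ≤ k ∧ k ≤ m ∧ ∀ p₀ : ℕ, ∃ (p : ℕ) (_ : Fact p.Prime), p₀ ≤ p ∧
      ∃ X Y Z : Finset (GLm p m), RankSep k X Y Z ∧
        (p : ℝ) ^ (3 * (m : ℝ) * k - 3 / 2 * (k : ℝ) ^ 2 - δ) ≤ volume X Y Z := by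
  sorry

/-! ## The family branch (lead reshape v3): sharp level pinning modulo Green's degree formula

If G dies at every fixed cell (a fixed-cell barrier `V = o(D_k^{3/2})`), the line survives in its `k → ∞` form:
designs with a loss `p^{δk}` against the wall, for every `δ > 0` at some cell — the card's level pinning
"V = D^{3/2} p^{-ck} proves ω ≤ 2 + 4c/(3-2c)".  This needs the SHARP budget, whose only non-elementary input is
the degree bound `d_max(GL_k(𝔽_p)) ≤ 2^k p^{k(k-1)/2}` (Green 1955; Macdonald 1995 Ch. IV §6 (6.7)), filed as the
Literature named fact `GreenGLnDegreeBound` (p92471, statement only) and registered here as stub H. -/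

/-- **H `GreenDegreeBound`** (NAMED FACT, = `Literature.RepresentationTheory.FiniteGroups.GreenGLnDegreeBound`,
proposal p92471): every irreducible character of `GL_n(𝔽_p)` has degree `≤ 2^n p^{n(n-1)/2}` — immediate from Green's
degree formula `d_λ = ψ_n(q)∏_φ q_φ^{n(λ(φ)')} H̃_{λ(φ)}(q_φ)^{-1}` via `t^h - 1 ≥ t^h/2`.  Not provable in the tree
today (Green's theory); the family branch is CONDITIONAL on it.  [cite: Macdonald1995, Ch. IV §6 (6.7)-(6.8)] -/
def GreenDegreeBound : Prop :=
  ∀ (n p : ℕ) [Fact p.Prime], ∀ χ ∈ irrChars (GLm p n), (χ 1).re ≤ 2 ^ n * (p : ℝ) ^ ((n : ℝ) * (n - 1) / 2)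

/-- Registered stub H (statement = `GreenDegreeBound`; a named fact — to be IMPORTED from Literature once p92471
lands, never proved here). -/
theorem stub_greenDegreeBound :
    ∀ (n p : ℕ) [Fact p.Prime], ∀ χ ∈ irrChars (GLm p n), (χ 1).re ≤ 2 ^ n * (p : ℝ) ^ ((n : ℝ) * (n - 1) / 2) := by
  sorry

/-- **I `SharpLevelDegree`** (size M/L, provable from H): for `χ ∈ Irr(GL_m(𝔽_p)) ∩ F_k`,
`χ(1) ≤ [G:P_k]·d_max(GL_k(𝔽_p)) ≤ 2^{m+k} p^{mk - k²/2 - k/2}`: A gives `V^{H_k} ≠ 0`, an irreducible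
`P_k`-subrepresentation `θ ≤ V^{H_k}` is `H_k`-trivial hence an irreducible representation of `P_k/H_k ≅ GL_k`
(pull back along the block-diagonal section), C gives `d ≤ [G:P_k]·dim θ`, H bounds `dim θ`, B bounds `[G:P_k]`. -/
def SharpLevelDegree : Prop :=
  ∀ (p m k : ℕ) [Fact p.Prime], 1 ≤ k → k ≤ m →
    ∀ χ ∈ irrChars (GLm p m) ∩ levelSet p m k,
      (χ 1).re ≤ 2 ^ (m + k) * (p : ℝ) ^ ((m : ℝ) * k - (k : ℝ) ^ 2 / 2 - (k : ℝ) / 2)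

/-- Registered stub I (statement = `GreenDegreeBound → SharpLevelDegree`, both inlined) — LANDED p93375. -/
theorem stub_sharpLevelDegree :
    (∀ (n p : ℕ) [Fact p.Prime], ∀ χ ∈ irrChars (GLm p n), (χ 1).re ≤ 2 ^ n * (p : ℝ) ^ ((n : ℝ) * (n - 1) / 2)) →
      ∀ (p m k : ℕ) [Fact p.Prime], 1 ≤ k → k ≤ m →
        ∀ χ ∈ irrChars (GLm p m) ∩ levelSet p m k,
          (χ 1).re ≤ 2 ^ (m + k) * (p : ℝ) ^ ((m : ℝ) * k - (k : ℝ) ^ 2 / 2 - (k : ℝ) / 2) := by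
  exact Summit.MatrixMultiplication.MatrixMultiplication.Theorems.LieRankDesigns.stub_sharpLevelDegree

/-- **`SharpCellBudget`** — level pinning with the Harish-Chandra slack: for `p` prime, `1 ≤ k ≤ m`, `s ≥ 2`,
`budget_s ≤ 2^{(m+k)(s-2)+m} · p^{(2mk-k²) + (s-2)(mk-k²/2-k/2)}` (J, PROVED below from I and `CellBudget`). -/
def SharpCellBudget : Prop :=
  ∀ (p m k : ℕ) [Fact p.Prime], 1 ≤ k → k ≤ m → ∀ s : ℝ, 2 ≤ s →
    budget p m k s ≤
      2 ^ (((m : ℝ) + k) * (s - 2) + m) *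
        (p : ℝ) ^ ((2 * (m : ℝ) * k - (k : ℝ) ^ 2) + (s - 2) * ((m : ℝ) * k - (k : ℝ) ^ 2 / 2 - (k : ℝ) / 2))

/-- **G' `FamilySaturation`** (the family form of the closer; OPEN, held by the lead): for every loss rate `δ > 0`
some cell `(m, k)`, `1 ≤ k ≤ m`, carries, along unboundedly many primes `p`, rank-`≤ k`-separated triples with
`|X||Y||Z| ≥ p^{3mk - 3k²/2 - δk}` (the wall up to `p^{δk}`).  Implied by G (`familySaturation_of_fixedCell`);
strictly weaker for `k ≥ 2`; the card's `C⁺(2k,k)` ("pieces of size `p^{1.5k²-o(k)}`") is its `m = 2k` instance.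
Why it might fail: as G, plus: it is the full conjectural content of the Lie engine (no family is known; a GRADED
mixing bound `V ≲ D_k^{3/2} p^{-ck}` with `c > 0` fixed would refute it for `δ < c`). -/
def FamilySaturation : Prop :=
  ∀ δ : ℝ, 0 < δ → ∃ m k : ℕ, 1 ≤ k ∧ k ≤ m ∧ ∀ p₀ : ℕ, ∃ (p : ℕ) (_ : Fact p.Prime), p₀ ≤ p ∧
    ∃ X Y Z : Finset (GLm p m), RankSep k X Y Z ∧
      (p : ℝ) ^ (3 * (m : ℝ) * k - 3 / 2 * (k : ℝ) ^ 2 - δ * k) ≤ volume X Y Z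

/-- Registered stub G' (statement = `FamilySaturation`, unfolded one level). -/
theorem stub_familySaturation :
    ∀ δ : ℝ, 0 < δ → ∃ m k : ℕ, 1 ≤ k ∧ k ≤ m ∧ ∀ p₀ : ℕ, ∃ (p : ℕ) (_ : Fact p.Prime), p₀ ≤ p ∧
      ∃ X Y Z : Finset (GLm p m), RankSep k X Y Z ∧
        (p : ℝ) ^ (3 * (m : ℝ) * k - 3 / 2 * (k : ℝ) ^ 2 - δ * k) ≤ volume X Y Z := by
  sorry

/-! ## Frame duality, exact form — in the lead's true copy: `irrChars_inter_levelSet_eq` (A p87876 + K p93384 +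
L p93570, all landed): `Irr ∩ F_k = {χ : Σ_{H_k} χ ≠ 0}`, so `budget p m k s = Σ_{ρ^{H_k} ≠ 0} (dim ρ)^s` exactly.
(Omitted from this published copy only because the farm has not rebuilt the K/L modules.) -/

/-! ### Registered-stub aliases (hypothesis heads of `LieRankDesigns_of` are matched by short name)
Stubs A–F are LANDED (wave 1, 2026-08-16: p87876, p89272, p89717, p90134, p90736, p91913), so the only hypothesis
left is G. -/
namespace Registered

/-- Statement of registered stub G (open; strongest design form). -/
abbrev stub_fixedCellSaturation : Prop := FixedCellSaturation
/-- Statement of registered stub G'' (open; hypothesis of the unconditional skeleton theorem). -/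
abbrev stub_nearWallDesigns : Prop := NearWallDesigns
/-- Statement of registered stub H (named fact; family branch). -/
abbrev stub_greenDegreeBound : Prop := GreenDegreeBound
/-- Statement of registered stub I (provable from H; family branch). -/
abbrev stub_sharpLevelDegree : Prop := GreenDegreeBound → SharpLevelDegree
/-- Statement of registered stub G' (open; family branch). -/
abbrev stub_familySaturation : Prop := FamilySaturation

end Registered

/-- **`CellBudget` holds** (stubs A–F, all landed): the elementary graded budget of every cell `(m, k)`. -/
theorem cellBudget_holds : CellBudget :=
  stub_budgetGlue stub_levelFixedVector stub_parabolicFacts stub_orbitSpanBound stub_regularCount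
    stub_centralDegreeBound

/-! ## The transfers (proved): `CellBudget → NearWallDesigns → LieRankDesigns`, `G ⇒ G'' ⇒ G'` -/

/-- **The unconditional transfer from near-wall designs** (G''): with `s = 2+ε`, `δ := 3ε/(8s)` and
`e = mk - k²/2`, `CellBudget` gives `budget ≤ 2^{m(s-1)} p^{es} (p-1)^{-ε/2} ≤ 2^{m(s-1)+ε/2} p^{es-ε/2}` while
`V^{s/3} ≥ p^{es - ε/8}`; any prime with `p^{3ε/8} > 2^{m(s-1)+ε/2}` works. -/
theorem lieRankDesigns_of_cellBudget_of_nearWall (hB : CellBudget) (hS : NearWallDesigns) :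
    (∀ ε : ℝ, 0 < ε → ∃ (p : ℕ) (_ : Fact p.Prime) (m k : ℕ) (X Y Z : Finset (GLm p m)),
      RankSep k X Y Z ∧ budget p m k (2 + ε) < volume X Y Z ^ ((2 + ε) / 3)) := by
  intro ε hε
  set s : ℝ := 2 + ε with hs_def
  have hs2 : 2 ≤ s := by rw [hs_def]; linarith
  have hs0 : 0 < s := by linarith
  -- loss rate δ := 3ε/(8s), so that δ s / 3 = ε / 8
  set δ : ℝ := 3 * ε / (8 * s) with hδ_def
  have hδ : 0 < δ := by rw [hδ_def]; positivity
  obtain ⟨m, k, hk, hkm, hall⟩ := hS δ hδ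
  -- constant to beat: K := 2^{m(s-1) + ε/2}; need p^{3ε/8} > K
  set K : ℝ := 2 ^ ((m : ℝ) * (s - 1) + ε / 2) with hK_def
  have hK : 0 < K := by rw [hK_def]; positivity
  have hexp0 : 0 < 3 * ε / 8 := by positivity
  obtain ⟨N, hN⟩ := exists_nat_gt (K ^ (1 / (3 * ε / 8)) + 2)
  obtain ⟨p, hprime, hNp, X, Y, Z, hsep, hvol⟩ := hall N
  refine ⟨p, hprime, m, k, X, Y, Z, hsep, ?_⟩
  have hp2 : 2 ≤ p := hprime.out.two_le
  have hpR : (2 : ℝ) ≤ p := by exact_mod_cast hp2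
  have hp0 : (0 : ℝ) < p := by linarith
  have hq0 : (0 : ℝ) < (p : ℝ) - 1 := by linarith
  have hNR : (N : ℝ) ≤ p := by exact_mod_cast hNp
  have hKp : K < (p : ℝ) ^ (3 * ε / 8) := by
    have h1 : K ^ (1 / (3 * ε / 8)) < p := by linarith
    have h2 : (K ^ (1 / (3 * ε / 8))) ^ (3 * ε / 8) < (p : ℝ) ^ (3 * ε / 8) :=
      Real.rpow_lt_rpow (by positivity) h1 hexp0
    have h3 : (K ^ (1 / (3 * ε / 8))) ^ (3 * ε / 8) = K := by
      rw [← Real.rpow_mul hK.le]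
      have : (1 / (3 * ε / 8)) * (3 * ε / 8) = 1 := by field_simp
      rw [this, Real.rpow_one]
    rwa [h3] at h2
  -- budget side
  set e : ℝ := (m : ℝ) * k - (k : ℝ) ^ 2 / 2 with he_def
  have hbud := hB p m k hk hkm s hs2
  have hexp : (s - 2) / 2 = ε / 2 := by rw [hs_def]; ring
  rw [hexp] at hbud
  have hqpow : 0 < ((p : ℝ) - 1) ^ (ε / 2) := Real.rpow_pos_of_pos hq0 _
  have hbud' : budget p m k s ≤ 2 ^ ((m : ℝ) * (s - 1)) * (p : ℝ) ^ (e * s) / ((p : ℝ) - 1) ^ (ε / 2) := by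
    rw [le_div_iff₀ hqpow]; exact hbud
  -- (p-1)^{ε/2} ≥ p^{ε/2} / 2^{ε/2}
  have hhalf : (p : ℝ) / 2 ≤ (p : ℝ) - 1 := by linarith
  have hq1 : (p : ℝ) ^ (ε / 2) / 2 ^ (ε / 2) ≤ ((p : ℝ) - 1) ^ (ε / 2) := by
    rw [← Real.div_rpow hp0.le (by norm_num : (0:ℝ) ≤ 2)]
    exact Real.rpow_le_rpow (by positivity) hhalf (by positivity)
  have hpe2 : 0 < (p : ℝ) ^ (ε / 2) / 2 ^ (ε / 2) := by positivity
  have hbud'' : budget p m k s ≤ K * (p : ℝ) ^ (e * s - ε / 2) := by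
    calc budget p m k s ≤ 2 ^ ((m : ℝ) * (s - 1)) * (p : ℝ) ^ (e * s) / ((p : ℝ) - 1) ^ (ε / 2) := hbud'
      _ ≤ 2 ^ ((m : ℝ) * (s - 1)) * (p : ℝ) ^ (e * s) / ((p : ℝ) ^ (ε / 2) / 2 ^ (ε / 2)) :=
          div_le_div_of_nonneg_left (by positivity) hpe2 hq1
      _ = K * (p : ℝ) ^ (e * s - ε / 2) := by
          rw [hK_def, Real.rpow_add (by norm_num : (0:ℝ) < 2), Real.rpow_sub hp0]
          field_simp
  -- volume side: V^{s/3} ≥ p^{es - ε/8}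
  have hV3 : 3 * (m : ℝ) * k - 3 / 2 * (k : ℝ) ^ 2 - δ = 3 * e - δ := by rw [he_def]; ring
  rw [hV3] at hvol
  have hV0 : 0 ≤ volume X Y Z := by unfold volume; positivity
  have hlow : ((p : ℝ) ^ (3 * e - δ)) ^ (s / 3) ≤ volume X Y Z ^ (s / 3) :=
    Real.rpow_le_rpow (by positivity) hvol (by positivity)
  have hδs : (3 * e - δ) * (s / 3) = e * s - ε / 8 := by
    rw [hδ_def]; field_simp
  have hlow' : ((p : ℝ) ^ (3 * e - δ)) ^ (s / 3) = (p : ℝ) ^ (e * s - ε / 8) := by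
    rw [← Real.rpow_mul hp0.le, hδs]
  -- compare: K p^{es - ε/2} < p^{3ε/8} p^{es - ε/2} = p^{es - ε/8}
  have hmid : K * (p : ℝ) ^ (e * s - ε / 2) < (p : ℝ) ^ (e * s - ε / 8) := by
    have hpos : 0 < (p : ℝ) ^ (e * s - ε / 2) := Real.rpow_pos_of_pos hp0 _
    calc K * (p : ℝ) ^ (e * s - ε / 2)
        < (p : ℝ) ^ (3 * ε / 8) * (p : ℝ) ^ (e * s - ε / 2) := mul_lt_mul_of_pos_right hKp hpos
      _ = (p : ℝ) ^ (e * s - ε / 8) := by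
          rw [← Real.rpow_add hp0]; congr 1; ring
  have hdiv : (2 + ε) / 3 = s / 3 := by rw [hs_def]
  rw [hdiv]
  calc budget p m k s ≤ K * (p : ℝ) ^ (e * s - ε / 2) := hbud''
    _ < (p : ℝ) ^ (e * s - ε / 8) := hmid
    _ = ((p : ℝ) ^ (3 * e - δ)) ^ (s / 3) := hlow'.symm
    _ ≤ volume X Y Z ^ (s / 3) := hlow

/-- **G ⇒ G''** (same cell; `c₀ ≥ p^{-δ}` for `p` large). -/
theorem nearWallDesigns_of_fixedCell (hG : FixedCellSaturation) : NearWallDesigns := by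
  intro δ hδ
  obtain ⟨m, k, hk, hkm, c₀, hc₀, hall⟩ := hG
  refine ⟨m, k, hk, hkm, fun p₀ => ?_⟩
  obtain ⟨N, hN⟩ := exists_nat_gt ((1 / c₀) ^ (1 / δ) + p₀ + 1)
  obtain ⟨p, hprime, hNp, X, Y, Z, hsep, hvol⟩ := hall N
  have hNR : (N : ℝ) ≤ p := by exact_mod_cast hNp
  have hpos1 : (0:ℝ) ≤ (1 / c₀) ^ (1 / δ) := by positivity
  have hp0 : (0 : ℝ) < p := by
    have : (0:ℝ) ≤ (p₀ : ℝ) := by positivity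
    linarith
  have hp₀p : p₀ ≤ p := by
    have : (p₀ : ℝ) ≤ p := by linarith
    exact_mod_cast this
  refine ⟨p, hprime, hp₀p, X, Y, Z, hsep, le_trans ?_ hvol⟩
  have h1 : (1 / c₀) ^ (1 / δ) < p := by
    have : (0:ℝ) ≤ (p₀ : ℝ) := by positivity
    linarith
  have h2 : 1 / c₀ < (p : ℝ) ^ δ := by
    have h := Real.rpow_lt_rpow (by positivity) h1 hδ
    rwa [← Real.rpow_mul (by positivity), show (1 / δ) * δ = 1 by field_simp, Real.rpow_one] at h
  have h3 : 1 < c₀ * (p : ℝ) ^ δ := by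
    rw [div_lt_iff₀ hc₀] at h2; linarith
  have hsplit : (p : ℝ) ^ (3 * (m : ℝ) * k - 3 / 2 * (k : ℝ) ^ 2 - δ) * (p : ℝ) ^ δ =
      (p : ℝ) ^ (3 * (m : ℝ) * k - 3 / 2 * (k : ℝ) ^ 2) := by
    rw [← Real.rpow_add hp0]; congr 1; ring
  have hq : 0 < (p : ℝ) ^ (3 * (m : ℝ) * k - 3 / 2 * (k : ℝ) ^ 2 - δ) := Real.rpow_pos_of_pos hp0 _
  calc (p : ℝ) ^ (3 * (m : ℝ) * k - 3 / 2 * (k : ℝ) ^ 2 - δ)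
      = (p : ℝ) ^ (3 * (m : ℝ) * k - 3 / 2 * (k : ℝ) ^ 2 - δ) * 1 := by ring
    _ ≤ (p : ℝ) ^ (3 * (m : ℝ) * k - 3 / 2 * (k : ℝ) ^ 2 - δ) * (c₀ * (p : ℝ) ^ δ) :=
        mul_le_mul_of_nonneg_left h3.le hq.le
    _ = c₀ * (p : ℝ) ^ (3 * (m : ℝ) * k - 3 / 2 * (k : ℝ) ^ 2) := by rw [← hsplit]; ring

/-- **G'' ⇒ G'** (`p^{-δk} ≤ p^{-δ}`). -/
theorem familySaturation_of_nearWall (hG : NearWallDesigns) : FamilySaturation := by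
  intro δ hδ
  obtain ⟨m, k, hk, hkm, hall⟩ := hG δ hδ
  refine ⟨m, k, hk, hkm, fun p₀ => ?_⟩
  obtain ⟨p, hprime, hp₀p, X, Y, Z, hsep, hvol⟩ := hall p₀
  refine ⟨p, hprime, hp₀p, X, Y, Z, hsep, le_trans ?_ hvol⟩
  have hp1 : (1 : ℝ) ≤ p := by exact_mod_cast hprime.out.one_lt.le
  have hkR : (1 : ℝ) ≤ k := by exact_mod_cast hk
  apply Real.rpow_le_rpow_of_exponent_le hp1
  nlinarith


/-- **THE SKELETON closes the crux modulo the ONE registered open stub G'' (near-wall designs), BY NAME** —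
unconditionally: `cellBudget_holds` (A–F, landed) and `lieRankDesigns_of_cellBudget_of_nearWall`. -/
theorem LieRankDesigns_of (hG : Registered.stub_nearWallDesigns) :
    Summit.MatrixMultiplication.MatrixMultiplication.Theses.LevelGradedCohnUmans.LieRankDesigns :=
  lieRankDesigns_iff.2 (lieRankDesigns_of_cellBudget_of_nearWall cellBudget_holds hG)

/-- The crux from the STRONGEST design form G (fixed cell, constant factor), via `G ⇒ G''`. -/
theorem LieRankDesigns_of_fixedCell (hG : Registered.stub_fixedCellSaturation) :
    Summit.MatrixMultiplication.MatrixMultiplication.Theses.LevelGradedCohnUmans.LieRankDesigns :=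
  LieRankDesigns_of (nearWallDesigns_of_fixedCell hG)

/-- How the closed proof is obtained once G'' (or G) lands. -/
example : Summit.MatrixMultiplication.MatrixMultiplication.Theses.LevelGradedCohnUmans.LieRankDesigns :=
  LieRankDesigns_of stub_nearWallDesigns

/-! ## The family transfer (proved): `SharpCellBudget → FamilySaturation → LieRankDesigns`, and J -/

/-- **The family transfer** (level pinning with the Harish-Chandra slack `p^{εk/2}`): given `ε > 0` put `s = 2+ε`,
`δ := 3ε/(4s)`; G' supplies a cell `(m,k)` and primes with `V ≥ p^{3e - δk}` (`e = mk - k²/2`), so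
`V^{s/3} ≥ p^{es - εk/4}`, while `SharpCellBudget` gives `budget ≤ 2^{(m+k)ε+m} p^{es - εk/2}`; any prime with
`p^{εk/4} > 2^{(m+k)ε+m}` works. -/
theorem lieRankDesigns_of_sharpCellBudget_of_family (hB : SharpCellBudget) (hS : FamilySaturation) :
    (∀ ε : ℝ, 0 < ε → ∃ (p : ℕ) (_ : Fact p.Prime) (m k : ℕ) (X Y Z : Finset (GLm p m)),
      RankSep k X Y Z ∧ budget p m k (2 + ε) < volume X Y Z ^ ((2 + ε) / 3)) := by
  intro ε hε
  set s : ℝ := 2 + ε with hs_def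
  have hs2 : 2 ≤ s := by rw [hs_def]; linarith
  have hs0 : 0 < s := by linarith
  -- choose the loss rate δ = 3ε/(4s), so that δ k s / 3 = ε k / 4
  set δ : ℝ := 3 * ε / (4 * s) with hδ_def
  have hδ : 0 < δ := by rw [hδ_def]; positivity
  obtain ⟨m, k, hk, hkm, hall⟩ := hS δ hδ
  have hkR : (1 : ℝ) ≤ k := by exact_mod_cast hk
  have hk0 : (0 : ℝ) < k := by linarith
  -- the constant to beat: C := 2^{(m+k)(s-2)+m}; need p^{εk/4} > C
  set C : ℝ := 2 ^ (((m : ℝ) + k) * (s - 2) + m) with hC_def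
  have hC : 0 < C := by rw [hC_def]; positivity
  have hexp0 : 0 < ε * k / 4 := by positivity
  obtain ⟨N, hN⟩ := exists_nat_gt (C ^ (1 / (ε * k / 4)) + 2)
  obtain ⟨p, hprime, hNp, X, Y, Z, hsep, hvol⟩ := hall N
  refine ⟨p, hprime, m, k, X, Y, Z, hsep, ?_⟩
  have hp2 : 2 ≤ p := hprime.out.two_le
  have hpR : (2 : ℝ) ≤ p := by exact_mod_cast hp2
  have hp0 : (0 : ℝ) < p := by linarith
  have hp1 : (1 : ℝ) ≤ p := by linarith
  have hNR : (N : ℝ) ≤ p := by exact_mod_cast hNp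
  -- C < p^{εk/4}
  have hCp : C < (p : ℝ) ^ (ε * k / 4) := by
    have h1 : C ^ (1 / (ε * k / 4)) < p := by linarith
    have h2 : (C ^ (1 / (ε * k / 4))) ^ (ε * k / 4) < (p : ℝ) ^ (ε * k / 4) :=
      Real.rpow_lt_rpow (by positivity) h1 hexp0
    have h3 : (C ^ (1 / (ε * k / 4))) ^ (ε * k / 4) = C := by
      rw [← Real.rpow_mul hC.le]
      have : (1 / (ε * k / 4)) * (ε * k / 4) = 1 := by field_simp
      rw [this, Real.rpow_one]
    rwa [h3] at h2
  -- exponents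
  set e : ℝ := (m : ℝ) * k - (k : ℝ) ^ 2 / 2 with he_def
  have hbud := hB p m k hk hkm s hs2
  have hE1 : (2 * (m : ℝ) * k - (k : ℝ) ^ 2) + (s - 2) * ((m : ℝ) * k - (k : ℝ) ^ 2 / 2 - (k : ℝ) / 2)
      = e * s - ε * k / 2 := by
    rw [he_def, hs_def]; ring
  rw [hE1] at hbud
  have hV3 : 3 * (m : ℝ) * k - 3 / 2 * (k : ℝ) ^ 2 - δ * k = 3 * e - δ * k := by rw [he_def]; ring
  rw [hV3] at hvol
  have hV0 : 0 ≤ volume X Y Z := by unfold volume; positivity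
  have hlow : ((p : ℝ) ^ (3 * e - δ * k)) ^ (s / 3) ≤ volume X Y Z ^ (s / 3) :=
    Real.rpow_le_rpow (by positivity) hvol (by positivity)
  have hδks : (3 * e - δ * k) * (s / 3) = e * s - ε * k / 4 := by
    rw [hδ_def]; field_simp
  have hlow' : ((p : ℝ) ^ (3 * e - δ * k)) ^ (s / 3) = (p : ℝ) ^ (e * s - ε * k / 4) := by
    rw [← Real.rpow_mul hp0.le, hδks]
  -- split the powers of p
  have hsplit1 : (p : ℝ) ^ (e * s - ε * k / 2) = (p : ℝ) ^ (e * s - ε * k / 4) / (p : ℝ) ^ (ε * k / 4) := by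
    rw [← Real.rpow_sub hp0]; congr 1; ring
  have hppos : 0 < (p : ℝ) ^ (ε * k / 4) := Real.rpow_pos_of_pos hp0 _
  have hqpos : 0 < (p : ℝ) ^ (e * s - ε * k / 4) := Real.rpow_pos_of_pos hp0 _
  have hfinal : C * (p : ℝ) ^ (e * s - ε * k / 2) < (p : ℝ) ^ (e * s - ε * k / 4) := by
    rw [hsplit1, mul_div_assoc', div_lt_iff₀ hppos]
    calc C * (p : ℝ) ^ (e * s - ε * k / 4)
        < (p : ℝ) ^ (ε * k / 4) * (p : ℝ) ^ (e * s - ε * k / 4) := mul_lt_mul_of_pos_right hCp hqpos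
      _ = (p : ℝ) ^ (e * s - ε * k / 4) * (p : ℝ) ^ (ε * k / 4) := by ring
  have hdiv : (2 + ε) / 3 = s / 3 := by rw [hs_def]
  rw [hdiv]
  calc budget p m k s
      ≤ C * (p : ℝ) ^ (e * s - ε * k / 2) := hbud
    _ < (p : ℝ) ^ (e * s - ε * k / 4) := hfinal
    _ = ((p : ℝ) ^ (3 * e - δ * k)) ^ (s / 3) := hlow'.symm
    _ ≤ volume X Y Z ^ (s / 3) := hlow

/-- The `s = 2` wall from `CellBudget`: `budget p m k 2 ≤ 2^m p^{2mk - k²}`. -/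
theorem wall_of_cellBudget (hB : CellBudget) (p m k : ℕ) [Fact p.Prime] (hk : 1 ≤ k) (hkm : k ≤ m) :
    budget p m k 2 ≤ 2 ^ (m : ℝ) * (p : ℝ) ^ (2 * (m : ℝ) * k - (k : ℝ) ^ 2) := by
  have h := hB p m k hk hkm 2 le_rfl
  have h0 : ((2 : ℝ) - 2) / 2 = 0 := by norm_num
  rw [h0, Real.rpow_zero, mul_one] at h
  have h1 : (m : ℝ) * (2 - 1) = m := by ring
  have h2 : ((m : ℝ) * k - (k : ℝ) ^ 2 / 2) * 2 = 2 * (m : ℝ) * k - (k : ℝ) ^ 2 := by ring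
  rw [h1, h2] at h
  exact h


/-- **J (sharp glue), proved.** `SharpLevelDegree → CellBudget → SharpCellBudget`:
`Σ_S d^s = Σ_S d^{s-2} d² ≤ D^{s-2} Σ_S d² = D^{s-2}·budget₂ ≤ D^{s-2} 2^m p^{2mk-k²}` with
`D = 2^{m+k} p^{mk-k²/2-k/2}`. -/
theorem sharpCellBudget_of (hI : SharpLevelDegree) (hB : CellBudget) : SharpCellBudget := by
  intro p m k _ hk hkm s hs
  have hwall := wall_of_cellBudget hB p m k hk hkm
  have hp2 : 2 ≤ p := (Fact.out : p.Prime).two_le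
  have hpR : (2 : ℝ) ≤ p := by exact_mod_cast hp2
  have hp0 : (0 : ℝ) < p := by linarith
  set e₁ : ℝ := (m : ℝ) * k - (k : ℝ) ^ 2 / 2 - (k : ℝ) / 2 with he₁
  set e₂ : ℝ := 2 * (m : ℝ) * k - (k : ℝ) ^ 2 with he₂
  set D : ℝ := 2 ^ (m + k) * (p : ℝ) ^ e₁ with hD_def
  have hD0 : 0 ≤ D := by rw [hD_def]; positivity
  -- termwise: d^s ≤ D^{s-2} d^2 for χ ∈ S
  have hfin : (irrChars (GLm p m) ∩ levelSet p m k).Finite :=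
    (irrChars_finite_holds (GLm p m)).subset Set.inter_subset_left
  have hterm : ∀ χ ∈ hfin.toFinset, (χ 1).re ^ s ≤ D ^ (s - 2) * (χ 1).re ^ (2 : ℝ) := by
    intro χ hχ
    have hχ' := hfin.mem_toFinset.1 hχ
    obtain ⟨n, -, hn⟩ := IsIrrChar.exists_apply_one hχ'.1
    have hdn : (χ 1).re = n := by rw [hn]; simp
    have hd0 : 0 ≤ (χ 1).re := by rw [hdn]; positivity
    have hdD : (χ 1).re ≤ D := hI p m k hk hkm χ hχ'
    have hsplit : (χ 1).re ^ s = (χ 1).re ^ (s - 2) * (χ 1).re ^ (2 : ℝ) := by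
      rw [← Real.rpow_add' hd0 (by linarith : s - 2 + 2 ≠ 0)]; congr 1; ring
    rw [hsplit]
    exact mul_le_mul_of_nonneg_right (Real.rpow_le_rpow hd0 hdD (by linarith)) (by positivity)
  have hbud2 : budget p m k 2 = ∑ χ ∈ hfin.toFinset, (χ 1).re ^ (2 : ℝ) := by
    unfold budget; rw [finsum_mem_eq_finite_toFinset_sum _ hfin]
  have hbuds : budget p m k s = ∑ χ ∈ hfin.toFinset, (χ 1).re ^ s := by
    unfold budget; rw [finsum_mem_eq_finite_toFinset_sum _ hfin]
  -- the algebra of the constants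
  have h2nat : ((2 : ℝ) ^ (m + k) : ℝ) = (2 : ℝ) ^ ((m : ℝ) + k) := by
    rw [← Real.rpow_natCast]; push_cast; ring_nf
  have hDpow : D ^ (s - 2) = 2 ^ (((m : ℝ) + k) * (s - 2)) * (p : ℝ) ^ (e₁ * (s - 2)) := by
    rw [hD_def, Real.mul_rpow (by positivity) (by positivity), h2nat,
      ← Real.rpow_mul (by norm_num : (0:ℝ) ≤ 2), ← Real.rpow_mul hp0.le]
  have hconst : D ^ (s - 2) * (2 ^ (m : ℝ) * (p : ℝ) ^ e₂) =
      2 ^ (((m : ℝ) + k) * (s - 2) + m) * (p : ℝ) ^ (e₂ + (s - 2) * e₁) := by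
    rw [hDpow, Real.rpow_add (by norm_num : (0:ℝ) < 2), Real.rpow_add hp0]
    have : e₁ * (s - 2) = (s - 2) * e₁ := by ring
    rw [this]; ring
  calc budget p m k s = ∑ χ ∈ hfin.toFinset, (χ 1).re ^ s := hbuds
    _ ≤ ∑ χ ∈ hfin.toFinset, D ^ (s - 2) * (χ 1).re ^ (2 : ℝ) := Finset.sum_le_sum hterm
    _ = D ^ (s - 2) * budget p m k 2 := by rw [hbud2, Finset.mul_sum]
    _ ≤ D ^ (s - 2) * (2 ^ (m : ℝ) * (p : ℝ) ^ e₂) :=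
        mul_le_mul_of_nonneg_left hwall (by positivity)
    _ = 2 ^ (((m : ℝ) + k) * (s - 2) + m) * (p : ℝ) ^ (e₂ + (s - 2) * e₁) := hconst


/-- **G ⇒ G'** (through G''). -/
theorem familySaturation_of_fixedCell (hG : FixedCellSaturation) : FamilySaturation :=
  familySaturation_of_nearWall (nearWallDesigns_of_fixedCell hG)

/-- **The family skeleton: the crux modulo H (Green's degree bound, named fact), I (provable) and G' (open),
BY NAME** — a second concluding theorem (the fixed-cell `LieRankDesigns_of` above is the unconditional one). -/
theorem LieRankDesigns_of_family (hH : Registered.stub_greenDegreeBound) (hI : Registered.stub_sharpLevelDegree)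
    (hG' : Registered.stub_familySaturation) :
    Summit.MatrixMultiplication.MatrixMultiplication.Theses.LevelGradedCohnUmans.LieRankDesigns :=
  lieRankDesigns_iff.2 (lieRankDesigns_of_sharpCellBudget_of_family (sharpCellBudget_of (hI hH) cellBudget_holds) hG')

/-- How the conditional proof is obtained once I and G' land (H stays a named fact). -/
example : Summit.MatrixMultiplication.MatrixMultiplication.Theses.LevelGradedCohnUmans.LieRankDesigns :=
  LieRankDesigns_of_family stub_greenDegreeBound stub_sharpLevelDegree stub_familySaturation

end Summit.MatrixMultiplication.MatrixMultiplication.Cruxes.LieRankDesigns.Sketch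

end
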